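/-
Copyright: statement-level skeleton of a published paper (lit-balaban cell, Phase-2 proof seat p19, gen 2). No claims beyond
what the kernel checks below.
-/
import Mathlib
import Literature.MathematicalPhysics.QuantumFieldTheory.Balaban1983to89.B3Ineq215CubeGeometry

/-!
# B3 — T. Bałaban, *(Higgs)₂,₃ quantum fields in a finite volume. III. Renormalization*, CMP **88** (1983) 411–445
[Balaban1983Higgs3] — Sect. 2, p. 427: the same-scale decay sum behind *"we use it to make the summation over Δ(v′)"*

statement-level skeleton of published theorems with citation tags; proofs where landed; nothing here is a claim about
the Yang–Mills mass gap

PDF held: `paper:balaban1983-higgs-2-3-quantum-fields-finite-volume` (journal page = PDF page + 410); displays read on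
the ×2 renders `pub-balaban/b2b-balaban-ref1/pages/1983-cmp88-higgs23-III/1983-cmp88-higgs23-III-p014 … p018-x2.png`
(pp. 424–428).

Part of the Phase-2 proof of SKELETON rows **B3.Eq2.15-2.16** (unit `lit-balaban-p19` gen 2, HOME
`run/shared/lean/pub/lit-balaban/`): files `B3Ineq215CubeGeometry` → `B3Ineq215DecaySum`, `B3Ineq215Quotient` →
`B3Ineq215Degrees` → `B3Ineq215Reroute` → `B3Ineq215Step` → `B3Ineq215Proof` (the theorem `Model.ineq215`), all in the
sub-namespace `…Balaban1983to89.B3Ineq215`; the rows were typed by r15 in `B3Sect2FirstEstimate`.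

WHAT IS REPRODUCED.  p. 427 [PDF 17]: *"We have still one exponential exp[−δ₂(L^jη)^{−1}dist(Δ(v), Δ(v′))] for the line l
and we use it to make the summation over Δ(v′). We get some constant O(1) depending on δ₁ and n̄ only, because the
linear sizes of Δ(v), Δ(v′) are equal to L^jη"* — KERNEL-CHECKED on the concrete cubes of `B3Ineq215CubeGeometry`: for a
cube `A` of scale `s` and any finite family of cubes of the same scale, `Σ_B exp[−δ dist(A,B)/L^s] ≤ K(δ, d)` with the
explicit constant `Cube.Kdec δ d = e^δ (2/(1 − e^{−δ/d}))^d`, uniformly in `s`, `A` and the family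
(`Cube.sum_exp_distI_le`; η-units, `dist/L^s = (L^sη)^{−1}·(η·dist)`).  (The one-coordinate Fubini lemma used to isolate the
coordinate `Δ(v′)` is the landed `Literature.AlgebraicTopology.CellComplexes.CubicalTorus.sum_piFinset_update`.)
Nothing of the paper is asserted.
-/

open Finset

namespace Literature.MathematicalPhysics.QuantumFieldTheory.Balaban1983to89.B3Ineq215

variable {d : ℕ} {L : ℕ}

namespace Cube

/-! ## (c) the same-scale decay sum -/

/-- For two cubes of the same scale `s`, each coordinate gap is `L^s(|z_μ − z′_μ| − 1)₊`; in particular it dominates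
that quantity. [cite: Balaban1983Higgs3, p.427] -/
theorem gap_sameScale_ge {A B : Cube d} (h : B.s = A.s) (μ : Fin d) :
    L ^ A.s * (Nat.dist (A.z μ) (B.z μ) - 1) ≤ gap L A B μ := by
  unfold gap lo hi
  rw [h]
  rcases le_total (A.z μ) (B.z μ) with hle | hle
  · rw [Nat.dist_eq_sub_of_le hle]
    refine le_trans ?_ (le_max_right _ _)
    rw [← mul_tsub]
    exact Nat.mul_le_mul_left _ (by omega)
  · rw [Nat.dist_eq_sub_of_le_right hle]
    refine le_trans ?_ (le_max_left _ _)
    rw [← mul_tsub]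
    exact Nat.mul_le_mul_left _ (by omega)

/-- The one-dimensional decay sum: `Σ_{z ∈ S} e^{−c|z₀ − z|} ≤ 2/(1 − e^{−c})` for any finite `S ⊂ ℕ`, `c > 0`
(private helper for `sum_exp_distI_le`). [folklore] -/
private theorem sum_exp_natDist_le {c : ℝ} (hc : 0 < c) (z₀ : ℕ) (S : Finset ℕ) :
    ∑ z ∈ S, Real.exp (-(c * Nat.dist z₀ z)) ≤ 2 / (1 - Real.exp (-c)) := by
  set r : ℝ := Real.exp (-c) with hr
  have hr0 : 0 ≤ r := (Real.exp_pos _).le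
  have hr1 : r < 1 := by rw [hr]; exact Real.exp_lt_one_iff.2 (by linarith)
  have hsum : Summable fun n : ℕ => r ^ n := summable_geometric_of_lt_one hr0 hr1
  have htsum : ∑' n : ℕ, r ^ n = (1 - r)⁻¹ := tsum_geometric_of_lt_one hr0 hr1
  have hterm : ∀ z, Real.exp (-(c * Nat.dist z₀ z)) = r ^ Nat.dist z₀ z := by
    intro z
    rw [hr, ← Real.exp_nat_mul]
    congr 1; ring
  simp_rw [hterm]
  -- split S into the part left of z₀ and the part right of z₀
  have hsplit : ∑ z ∈ S, r ^ Nat.dist z₀ z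
      ≤ ∑ z ∈ S.filter (· ≤ z₀), r ^ Nat.dist z₀ z + ∑ z ∈ S.filter (fun z => ¬ z ≤ z₀), r ^ Nat.dist z₀ z := by
    rw [← Finset.sum_filter_add_sum_filter_not S (· ≤ z₀)]
  have hleft : ∑ z ∈ S.filter (· ≤ z₀), r ^ Nat.dist z₀ z ≤ (1 - r)⁻¹ := by
    have hinj : Set.InjOn (fun z => z₀ - z) ↑(S.filter (· ≤ z₀)) := by
      intro a ha b hb hab
      simp only [Finset.coe_filter, Set.mem_setOf_eq] at ha hb
      have := hab; dsimp at this; omega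
    have e : ∑ z ∈ S.filter (· ≤ z₀), r ^ Nat.dist z₀ z = ∑ n ∈ (S.filter (· ≤ z₀)).image (fun z => z₀ - z), r ^ n := by
      rw [Finset.sum_image hinj]
      refine Finset.sum_congr rfl fun z hz => ?_
      simp only [Finset.mem_filter] at hz
      rw [Nat.dist_eq_sub_of_le_right hz.2]
    rw [e, ← htsum]
    exact hsum.sum_le_tsum _ (fun n _ => pow_nonneg hr0 n)
  have hright : ∑ z ∈ S.filter (fun z => ¬ z ≤ z₀), r ^ Nat.dist z₀ z ≤ (1 - r)⁻¹ := by
    have hinj : Set.InjOn (fun z => z - z₀) ↑(S.filter (fun z => ¬ z ≤ z₀)) := by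
      intro a ha b hb hab
      simp only [Finset.coe_filter, Set.mem_setOf_eq] at ha hb
      have := hab; dsimp at this; omega
    have e : ∑ z ∈ S.filter (fun z => ¬ z ≤ z₀), r ^ Nat.dist z₀ z
        = ∑ n ∈ (S.filter (fun z => ¬ z ≤ z₀)).image (fun z => z - z₀), r ^ n := by
      rw [Finset.sum_image hinj]
      refine Finset.sum_congr rfl fun z hz => ?_
      simp only [Finset.mem_filter] at hz
      rw [Nat.dist_eq_sub_of_le (by omega)]
    rw [e, ← htsum]
    exact hsum.sum_le_tsum _ (fun n _ => pow_nonneg hr0 n)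
  have h1r : 0 < 1 - r := by linarith
  calc ∑ z ∈ S, r ^ Nat.dist z₀ z ≤ (1 - r)⁻¹ + (1 - r)⁻¹ := hsplit.trans (add_le_add hleft hright)
    _ = 2 / (1 - r) := by rw [div_eq_mul_inv]; ring

/-- The constant of the same-scale decay sum: `K(δ, d) = e^δ (2/(1 − e^{−δ/d}))^d` (the paper's "some constant O(1)
depending on δ₁ and n̄ only"). [cite: Balaban1983Higgs3, p.427] -/
noncomputable def Kdec (δ : ℝ) (d : ℕ) : ℝ := Real.exp δ * (2 / (1 - Real.exp (-(δ / d)))) ^ d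

/-- `K(δ, d) > 0` for `δ > 0`, `d ≥ 1`. [cite: Balaban1983Higgs3, p.427] -/
theorem Kdec_pos {δ : ℝ} (hδ : 0 < δ) (hd : 0 < d) : 0 < Kdec δ d := by
  unfold Kdec
  have hc : 0 < δ / d := div_pos hδ (by exact_mod_cast hd)
  have : Real.exp (-(δ / d)) < 1 := Real.exp_lt_one_iff.2 (by linarith)
  have h2 : 0 < 2 / (1 - Real.exp (-(δ / d))) := div_pos two_pos (by linarith)
  positivity

/-- Pointwise: for cubes of the same scale `s`, `exp[−δ dist(A, B)/L^s] ≤ e^δ Π_μ e^{−(δ/d)|z_μ − z′_μ|}`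
(sup-distance ≥ mean of the coordinate gaps, each gap `≥ L^s(|z_μ − z′_μ| − 1)`). [cite: Balaban1983Higgs3, p.427] -/
theorem exp_distI_le_prod (hd : 0 < d) (hL : 0 < L) {δ : ℝ} (hδ : 0 ≤ δ) {A B : Cube d} (h : B.s = A.s) :
    Real.exp (-(δ * (distI L A B : ℝ) / (L : ℝ) ^ A.s))
      ≤ Real.exp δ * ∏ μ, Real.exp (-(δ / d * Nat.dist (A.z μ) (B.z μ))) := by
  have hLs : (0 : ℝ) < (L : ℝ) ^ A.s := by positivity
  have hdR : (0 : ℝ) < d := by exact_mod_cast hd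
  -- d · dist ≥ Σ_μ gap_μ ≥ L^s Σ_μ (|Δz_μ| − 1) ≥ L^s (Σ_μ |Δz_μ| − d)
  have hsum : (L : ℝ) ^ A.s * ((∑ μ, (Nat.dist (A.z μ) (B.z μ) : ℝ)) - d) ≤ d * (distI L A B : ℝ) := by
    have hμ : ∀ μ : Fin d, (L : ℝ) ^ A.s * ((Nat.dist (A.z μ) (B.z μ) : ℝ) - 1) ≤ (distI L A B : ℝ) := by
      intro μ
      have h1 : L ^ A.s * (Nat.dist (A.z μ) (B.z μ) - 1) ≤ distI L A B :=
        (gap_sameScale_ge h μ).trans (gap_le_distI A B μ)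
      have h2 : ((Nat.dist (A.z μ) (B.z μ) : ℝ) - 1) ≤ ((Nat.dist (A.z μ) (B.z μ) - 1 : ℕ) : ℝ) := by
        have := le_tsub_add (a := 1) (b := Nat.dist (A.z μ) (B.z μ))
        have : (Nat.dist (A.z μ) (B.z μ) : ℝ) ≤ ((Nat.dist (A.z μ) (B.z μ) - 1 : ℕ) : ℝ) + 1 := by
          exact_mod_cast this
        linarith
      have h1' : ((L : ℝ) ^ A.s) * ((Nat.dist (A.z μ) (B.z μ) - 1 : ℕ) : ℝ) ≤ (distI L A B : ℝ) := by
        exact_mod_cast h1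
      nlinarith
    calc (L : ℝ) ^ A.s * ((∑ μ, (Nat.dist (A.z μ) (B.z μ) : ℝ)) - d)
        = ∑ μ : Fin d, (L : ℝ) ^ A.s * ((Nat.dist (A.z μ) (B.z μ) : ℝ) - 1) := by
          rw [← Finset.mul_sum]
          congr 1
          rw [Finset.sum_sub_distrib]
          simp
      _ ≤ ∑ _μ : Fin d, (distI L A B : ℝ) := Finset.sum_le_sum fun μ _ => hμ μ
      _ = d * (distI L A B : ℝ) := by rw [Finset.sum_const, Finset.card_univ, Fintype.card_fin]; ring
  -- hence −δ dist/L^s ≤ δ − (δ/d) Σ_μ |Δz_μ|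
  have hkey : -(δ * (distI L A B : ℝ) / (L : ℝ) ^ A.s) ≤ δ + ∑ μ, -(δ / d * Nat.dist (A.z μ) (B.z μ)) := by
    rw [Finset.sum_neg_distrib, ← Finset.mul_sum]
    have : δ / d * ∑ μ, (Nat.dist (A.z μ) (B.z μ) : ℝ) - δ ≤ δ * (distI L A B : ℝ) / (L : ℝ) ^ A.s := by
      rw [le_div_iff₀ hLs]
      have := mul_le_mul_of_nonneg_left hsum (div_nonneg hδ hdR.le)
      have e1 : δ / d * (d * (distI L A B : ℝ)) = δ * (distI L A B : ℝ) := by field_simp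
      have e2 : δ / d * ((L : ℝ) ^ A.s * ((∑ μ, (Nat.dist (A.z μ) (B.z μ) : ℝ)) - d))
          = (δ / d * ∑ μ, (Nat.dist (A.z μ) (B.z μ) : ℝ) - δ) * (L : ℝ) ^ A.s := by
        field_simp
      rw [e1, e2] at this
      exact this
    linarith
  calc Real.exp (-(δ * (distI L A B : ℝ) / (L : ℝ) ^ A.s))
      ≤ Real.exp (δ + ∑ μ, -(δ / d * Nat.dist (A.z μ) (B.z μ))) := Real.exp_le_exp.2 hkey
    _ = Real.exp δ * ∏ μ, Real.exp (-(δ / d * Nat.dist (A.z μ) (B.z μ))) := by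
        rw [Real.exp_add, Real.exp_sum]

/-- p. 427 [PDF 17]: *"we use it to make the summation over Δ(v′). We get some constant O(1) depending on δ₁ and n̄ only,
because the linear sizes of Δ(v), Δ(v′) are equal to L^jη"* — for a cube `A` of scale `s` and ANY finite family `S` of
cubes of the same scale, `Σ_{B ∈ S} exp[−δ dist(A, B)/L^s] ≤ K(δ, d)`, uniformly in `s`, `A`, `S` (η-units: `dist/L^s =
(L^sη)^{−1} · (η · dist)`). [cite: Balaban1983Higgs3, p.427] -/
theorem sum_exp_distI_le (hd : 0 < d) (hL : 0 < L) {δ : ℝ} (hδ : 0 < δ) (A : Cube d) (S : Finset (Cube d))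
    (hS : ∀ B ∈ S, B.s = A.s) :
    ∑ B ∈ S, Real.exp (-(δ * (distI L A B : ℝ) / (L : ℝ) ^ A.s)) ≤ Kdec δ d := by
  classical
  have hc : 0 < δ / d := div_pos hδ (by exact_mod_cast hd)
  set g : Fin d → ℕ → ℝ := fun μ x => Real.exp (-(δ / d * Nat.dist (A.z μ) x)) with hg
  have hg0 : ∀ μ x, 0 ≤ g μ x := fun μ x => (Real.exp_pos _).le
  -- step 1: pointwise bound and passage to positions
  have h1 : ∑ B ∈ S, Real.exp (-(δ * (distI L A B : ℝ) / (L : ℝ) ^ A.s))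
      ≤ Real.exp δ * ∑ B ∈ S, ∏ μ, g μ (B.z μ) := by
    rw [Finset.mul_sum]
    exact Finset.sum_le_sum fun B hB => exp_distI_le_prod hd hL hδ.le (hS B hB)
  -- step 2: B ↦ B.z is injective on S (same scale), so the sum is over a finite set of positions
  have hinj : Set.InjOn Cube.z (S : Set (Cube d)) := by
    intro B hB B' hB' hz
    exact Cube.ext (by rw [hS B hB, hS B' hB']) hz
  have h2 : ∑ B ∈ S, ∏ μ, g μ (B.z μ) = ∑ z ∈ S.image Cube.z, ∏ μ, g μ (z μ) := by
    rw [Finset.sum_image hinj]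
  -- step 3: enlarge to the product box of the coordinate projections and factorize
  set T : Fin d → Finset ℕ := fun μ => (S.image Cube.z).image fun z => z μ with hT
  have hsub : S.image Cube.z ⊆ Fintype.piFinset T := by
    intro z hz
    exact Fintype.mem_piFinset.2 fun μ => Finset.mem_image.2 ⟨z, hz, rfl⟩
  have h3 : ∑ z ∈ S.image Cube.z, ∏ μ, g μ (z μ) ≤ ∑ z ∈ Fintype.piFinset T, ∏ μ, g μ (z μ) :=
    Finset.sum_le_sum_of_subset_of_nonneg hsub fun z _ _ => Finset.prod_nonneg fun μ _ => hg0 μ _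
  have h4 : ∑ z ∈ Fintype.piFinset T, ∏ μ, g μ (z μ) = ∏ μ, ∑ x ∈ T μ, g μ x :=
    (Finset.prod_univ_sum (t := T) (f := g)).symm
  have h5 : ∏ μ, ∑ x ∈ T μ, g μ x ≤ ∏ _μ : Fin d, 2 / (1 - Real.exp (-(δ / d))) := by
    refine Finset.prod_le_prod (fun μ _ => Finset.sum_nonneg fun x _ => hg0 μ x) fun μ _ => ?_
    exact sum_exp_natDist_le hc (A.z μ) (T μ)
  rw [Finset.prod_const, Finset.card_univ, Fintype.card_fin] at h5
  calc ∑ B ∈ S, Real.exp (-(δ * (distI L A B : ℝ) / (L : ℝ) ^ A.s))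
      ≤ Real.exp δ * ∑ B ∈ S, ∏ μ, g μ (B.z μ) := h1
    _ ≤ Real.exp δ * (2 / (1 - Real.exp (-(δ / d)))) ^ d := by
        refine mul_le_mul_of_nonneg_left ?_ (Real.exp_pos _).le
        rw [h2]; exact h3.trans (h4.le.trans h5)
    _ = Kdec δ d := rfl

end Cube

end Literature.MathematicalPhysics.QuantumFieldTheory.Balaban1983to89.B3Ineq215
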